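import Literature.Geometry.Kaehler.ComplexTorusAntisymplecticGraphQuotient
import Literature.Geometry.Kaehler.ComplexTorusComplementaryAdditionIsogeny
import Literature.Geometry.Kaehler.ComplexTorusComplementarySubtorusDegrees
import Literature.Geometry.Kaehler.ComplexTorusKHStructure
import Literature.Geometry.Kaehler.ComplexTorusPolarizedDecomposition
import Literature.NumberTheory.ComplexMultiplication.CMTorusEquivariantIsogenies
import HarnessLib

/-!
# Every principally polarised torus with a complementary pair `(Y, Z)` is Debarre's twisted product
# `(Y × Z)/graph(p)` (Iribar López 2024, Lemma 10, last assertion)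

Layer `Literature/Geometry/Kaehler`, namespace `Literature.Geometry.Kaehler.ComplexTorus`; lane `lit-hodgefound`
(Track 2 foundations library, Layer A4, row A4-76, seat `lit-hodgefound-skel-4`, FILE D of the row).  Sequel of
`ComplexTorusAntisymplecticGraphQuotient.lean` (FILE A: `graphSubgroup`, `IsAntisymplectic`, the twisted product
`(Y × Z)/graph(p)` and its principal polarisation; `forall_weilPairing_graphSubgroup_eq_one_iff`: the graph is
isotropic iff `p` is antisymplectic) and of p10's `ComplexTorusComplementaryAdditionIsogeny.lean` (the addition
isogeny `μ = ι_Y + ι_Z : Y × Z → X` of a complementary pair, `additionMatrix`, `additionRep`,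
`isIsogeny_addition_orthSubspace`, Lemma 5.3.6 `pullbackForm_additionRep_orthSubspace : μ^*Θ = ι_Y^*Θ ⊠ ι_Z^*Θ`,
`mem_ker_addition_iff`, Cor. 5.3.4 `IsPrincipalPolarization.natCard_ker_addition_eq_sq(')`), with
`ComplexTorusComplementarySubtorusDegrees.lean` (`IsSubPolarizationType.isPolarizationType_subtorusPeriod`),
`ComplexTorusKHStructure.lean` (`IsPolarizationType.natCard_kerPhiH : #K(H) = (∏ dᵢ)²`),
`ComplexTorusIsotropicDescent.lean` (Prop. 2.7.2 `forall_exists_int_iff_ker_isotropic`) and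
`CMTorusEquivariantIsogenies.lean` (`IsIsogeny.exists_unimodular_of_ker_eq`: isogenies with the same kernel differ
by a unimodular matrix with `ℂ`-linear analytic representation).

Source followed: A. Iribar López, *Noether–Lefschetz cycles on the moduli space of abelian varieties*, Forum Math. Pi
(2026), held text `paper:arxiv-2411.09910`, §2.2 p. 7 L124–L137, VERBATIM: "**Lemma 10.** With notation as above, for
any antisymplectic isomorphism `p : K(θ_Y) → K(θ_Z)`, the abelian variety `(Y × Z)/graph(p)` has a canonical
principal polarization `θ_p` and contains `(Y, θ_Y)`, `(Z, θ_Z)` as complementary subvarieties. Moreover, the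
isomorphism type of `((Y × Z)/graph(p), θ_p)` does not depend on `p`, and **all principally polarized abelian
varieties having `Y` and `Z` as complementary subvarieties arise this way**."  R. Auffarth, Math. Z. 282 (2016),
held text `paper:arxiv-1507.08618`, §3 p. 9 L49: "Debarre shows that `Φ_{u,n−u}(D)` is surjective".  H. Lange,
*Abelian Varieties over the Complex Numbers* (2023), §5.3.1 p. 263: "According to Corollary 2.4.24 the
homomorphism `μ = ι_Y + ι_Z : Y × Z → X` is an isogeny. […] **Lemma 5.3.6** The induced polarization on `Y × Z`
splits: `φ_{(ι_Y + ι_Z)^*Θ} = φ_Y × φ_Z`", Cor. 5.3.4 "`K(ι^*Θ) = ι⁻¹Z ≃ Y ∩ Z`", §2.7.1 Prop. 2.7.2 (p. 149: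
`L = f^*M` iff `Ker f` is isotropic in `K(L)`), §1.1.2 (p. 21: "up to isomorphisms every isogeny is of this type").

## The printed argument, at torus level

Let `(X, Θ)` (`ComplexTorus Φ`, `IsPrincipalPolarization Φ η`) contain the abelian subvariety `Y = π(V)` with
complement `Z = π(V^⊥)` (`orthSubspace Φ η V`); give `Y`, `Z` their own structures of complex tori
`ComplexTorus (subtorusPeriod Φ V hV hVc)`, `ComplexTorus (subtorusPeriod Φ V^⊥ hW hWc)` with induced polarisations
`θ_Y = ι_Y^*Θ = pullbackForm (cxSpan Φ V).subtypeL η`, `θ_Z` (Riemann forms, `isRiemannForm_restrict`), and let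
`μ : Y × Z → X` be the addition isogeny (`mapMatrixHom (prodPeriod …) Φ (additionMatrix V V^⊥)`).  §1: since
`μ^*Θ = θ_Y ⊠ θ_Z` is a pull-back along the isogeny `μ`, Prop. 2.7.2 gives `Ker μ ⊆ K(θ_Y ⊠ θ_Z) = K(θ_Y) × K(θ_Z)`
and `Ker μ` isotropic for `ε^{θ_Y ⊠ θ_Z}`; `Ker μ` meets `Y × 0` and `0 × Z` trivially (`ι_Y`, `ι_Z` are
injective).  §2: `#Ker μ = #K(θ_Y) = #K(θ_Z)` (Cor. 5.3.4/5.3.5 through the types, `Θ` principal).  §3: hence the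
two projections `Ker μ → K(θ_Y)`, `Ker μ → K(θ_Z)` are bijective and `Ker μ = graph(p)` for the isomorphism
`p = pr₂ ∘ pr₁⁻¹ : K(θ_Y) ≅ K(θ_Z)`, which is ANTISYMPLECTIC because its graph is isotropic.  §4: the quotient map
`π : Y × Z → (Y × Z)/Ker μ` and `μ` are isogenies with the same kernel, so `X ≅ (Y × Z)/Ker μ` by a unimodular
matrix whose analytic representation is that of `μ`, `(y, z) ↦ y + z`, which pulls `Θ` back to `θ_Y ⊠ θ_Z` —
an isomorphism of POLARISED tori `((Y × Z)/graph(p), θ_p) ≅ (X, Θ)`, `θ_p` the descended `θ_Y ⊠ θ_Z` of FILE A.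

## Main statements (all proved; no definition, no named fact, net debt 0)

* §1 `finite_ker_addition_orthSubspace`, **`ker_addition_le_kerPhiH_and_weilPairing_eq_one`** (`Ker μ ⊆ K(θ_Y ⊠ θ_Z)`
  isotropic), **`ker_addition_inf_subtorus_fstSubspace`** / **`…_sndSubspace`** (`= ⊥`);
* §2 `IsPrincipalPolarization.natCard_ker_addition_eq_natCard_kerPhiH_fst` / `…_snd` (`#Ker μ = #K(θ_Y) = #K(θ_Z)`);
* §3 **`IsPrincipalPolarization.exists_antisymplectic_graphSubgroup_eq_ker_addition`** — `Ker μ = graph(p)` for an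
  antisymplectic isomorphism `p : K(θ_Y) ≅ K(θ_Z)`;
* §4 **`exists_isPolarizedIso_quotientBy_ker_addition`** (`((Y × Z)/Ker μ, θ) ≅ (X, Θ)` as polarised tori, with
  `h ∘ π = μ`; any polarisation `Θ` with `Z = Y^⊥`), `exists_isPolarizedIso_quotientBy_of_eq_ker_addition`;
* §5 **`IsPrincipalPolarization.exists_antisymplectic_isPolarizedIso_quotientBy_graphSubgroup`** — LEMMA 10, LAST
  ASSERTION: `∃ p` antisymplectic, `graph(p) = Ker μ`, and `((Y × Z)/graph(p), θ_p) ≅ (X, Θ)` carrying `π` to `μ`;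
  the existence form `…'` (`p` as a bijective antisymplectic homomorphism, `(X, Θ) ≅ ((Y × Z)/graph(p), θ_p)`);
* §6 `map_subtorus_fstSubspace_eq_subtorus_of_comp_eq_addition` / `…_sndSubspace_…` — an isomorphism
  `h : (Y × Z)/Γ ≅ X` with `h ∘ π = μ` carries `π(Y × 0)` onto `Y = π(V)` and `π(0 × Z)` onto `Z = π(V^⊥)`;
  `IsPrincipalPolarization.exists_antisymplectic_isPolarizedIso_quotientBy_graphSubgroup_map_subtorus` (§5 with
  the identification of the complementary pairs).

NOT here: "does not depend on `p`" (the `Sp(K(δ))`-action, Iribar López's `τ`); the existence of antisymplectic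
isomorphisms for PRESCRIBED abstract pairs of complementary types (Def. 4's `f_Z ∘ r ∘ f_Y⁻¹`) is the sequel
`ComplexTorusAntisymplecticIsomorphismOfTypes.lean`, the Siegel-side reading `NL_{g,δ} ⊆ image(𝒫_{g,δ})` the sequel
`ModuliOfAbelianVarieties/SiegelFamilyNoetherLefschetzTwistedProductSurjective.lean`.

## References

* [IribarLopez2024NoetherLefschetzCycles] A. Iribar López, Forum Math. Pi (2026), arXiv:2411.09910, §2.2 Lemma 10 (p. 7).
* [Auffarth2016NonSimplePPAV] R. Auffarth, Math. Z. 282 (2016) 731–746, arXiv:1507.08618, §3 (p. 9), Thm. 3.5,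
  proof of Lemma 3.7 (p. 10).
* [Debarre1988ThetaSingulierCodim3] O. Debarre, Duke Math. J. 57 (1988) 221–273 (original construction; via the two
  sources above).
* [Lange2023AbelianVarietiesComplex] H. Lange, *Abelian Varieties over the Complex Numbers* (2023), §1.1.2 (p. 21),
  §2.4.4 Cor. 2.4.24, Prop. 2.4.29 (pp. 123–125), §2.7.1 Prop. 2.7.2 (p. 149), §5.3.1 Cor. 5.3.4, Cor. 5.3.5,
  Lemma 5.3.6 (p. 263).
-/

noncomputable section

open Complex Module Function Matrix

namespace Literature.Geometry.Kaehler

namespace ComplexTorus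

variable {ι : Type*} [Fintype ι] [DecidableEq ι] {E : Type*} [NormedAddCommGroup E] [NormedSpace ℂ E]
  (Φ : (ι → ℝ) ≃L[ℝ] E) {η : E [⋀^Fin 2]→L[ℝ] ℝ} {V : Submodule ℝ (ι → ℝ)}
  (hV : IsLatticeSubspace V) (hVc : IsComplexSubspace Φ V)
  (hW : IsLatticeSubspace (orthSubspace Φ η V)) (hWc : IsComplexSubspace Φ (orthSubspace Φ η V))

omit [Fintype ι] [DecidableEq ι] in
/-- `ρ(A)(0) = 0`. [folklore] -/
private theorem mapMatrix_zero' {κ κ' : Type*} [Fintype κ] {F F' : Type*} [NormedAddCommGroup F] [NormedSpace ℂ F]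
    [NormedAddCommGroup F'] [NormedSpace ℂ F'] (Ψ : (κ → ℝ) ≃L[ℝ] F) (Ψ' : (κ' → ℝ) ≃L[ℝ] F')
    (A : Matrix κ' κ ℤ) : mapMatrix Ψ Ψ' A 0 = 0 :=
  map_zero (mapMatrixHom Ψ Ψ' A)

omit [DecidableEq ι] in
/-- `(M N)_ℝ = M_ℝ N_ℝ` for integer matrices. [folklore] -/
private theorem map_mul_intCast {κ₁ κ₂ κ₃ : Type*} [Fintype κ₂] (M : Matrix κ₁ κ₂ ℤ) (N : Matrix κ₂ κ₃ ℤ) :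
    (M * N).map (Int.cast : ℤ → ℝ) = M.map (Int.cast : ℤ → ℝ) * N.map (Int.cast : ℤ → ℝ) :=
  Matrix.map_mul (f := Int.castRingHom ℝ)

/-! ### §1 The kernel of the addition isogeny `μ : Y × Z → X` is an isotropic subgroup of
`K(ι_Y^*L ⊠ ι_Z^*L)` meeting the factors trivially -/

omit [DecidableEq ι] in
/-- `Ker μ` is finite (`μ = ι_Y + ι_Z : Y × Z → X` is an isogeny, Cor. 2.4.24).
[cite: Lange2023AbelianVarietiesComplex, §2.4.4 Cor. 2.4.24, p. 123] -/
theorem finite_ker_addition_orthSubspace (hη : IsRiemannForm Φ η) :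
    Finite (mapMatrixHom (prodPeriod (subtorusPeriod Φ V hV hVc) (subtorusPeriod Φ (orthSubspace Φ η V) hW hWc))
      Φ (additionMatrix V (orthSubspace Φ η V))).ker :=
  (isIsogeny_addition_orthSubspace Φ hη hV hVc hW hWc).finite_ker

omit [DecidableEq ι] in
/-- **`Ker μ ⊆ K(μ^*L)` and `Ker μ` is isotropic for `ε^{μ^*L}`**, `μ^*L = ι_Y^*L ⊠ ι_Z^*L` (Prop. 2.7.2 (i) ⇒ (ii):
`μ^*L` IS a pull-back along the isogeny `μ`; integer Gram matrices `G_Y`, `G_Z` of the induced polarisations).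
[cite: Lange2023AbelianVarietiesComplex, §2.7.1 Prop. 2.7.2, p. 149] [cite: IribarLopez2024NoetherLefschetzCycles, §2.2 Lemma 10 ("all principally polarized abelian varieties having `Y` and `Z` as complementary subvarieties arise this way")] -/
theorem ker_addition_le_kerPhiH_and_weilPairing_eq_one (hη : IsRiemannForm Φ η)
    {GY : Matrix (Fin (subRank V)) (Fin (subRank V)) ℤ}
    {GZ : Matrix (Fin (subRank (orthSubspace Φ η V))) (Fin (subRank (orthSubspace Φ η V))) ℤ}
    (hGY : GY.map (Int.cast : ℤ → ℝ) = latticeGram (subtorusPeriod Φ V hV hVc) (pullbackForm (cxSpan Φ V).subtypeL η))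
    (hGZ : GZ.map (Int.cast : ℤ → ℝ) = latticeGram (subtorusPeriod Φ (orthSubspace Φ η V) hW hWc)
      (pullbackForm (cxSpan Φ (orthSubspace Φ η V)).subtypeL η)) :
    (mapMatrixHom (prodPeriod (subtorusPeriod Φ V hV hVc) (subtorusPeriod Φ (orthSubspace Φ η V) hW hWc)) Φ
        (additionMatrix V (orthSubspace Φ η V))).ker ≤
      kerPhiH (prodPeriod (subtorusPeriod Φ V hV hVc) (subtorusPeriod Φ (orthSubspace Φ η V) hW hWc))
        (Matrix.fromBlocks GY 0 0 GZ) ∧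
    ∀ s ∈ (mapMatrixHom (prodPeriod (subtorusPeriod Φ V hV hVc) (subtorusPeriod Φ (orthSubspace Φ η V) hW hWc))
        Φ (additionMatrix V (orthSubspace Φ η V))).ker,
      ∀ t ∈ (mapMatrixHom (prodPeriod (subtorusPeriod Φ V hV hVc)
          (subtorusPeriod Φ (orthSubspace Φ η V) hW hWc)) Φ (additionMatrix V (orthSubspace Φ η V))).ker,
        weilPairing (prodPeriod (subtorusPeriod Φ V hV hVc) (subtorusPeriod Φ (orthSubspace Φ η V) hW hWc))
          (prodForm (pullbackForm (cxSpan Φ V).subtypeL η)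
            (pullbackForm (cxSpan Φ (orthSubspace Φ η V)).subtypeL η)) s t = 1 := by
  obtain ⟨F, hF⟩ := (isIsogeny_addition_orthSubspace Φ hη hV hVc hW hWc).exists_continuousLinearEquiv
    (prodPeriod (subtorusPeriod Φ V hV hVc) (subtorusPeriod Φ (orthSubspace Φ η V) hW hWc)) Φ
  have hG := fromBlocks_map_eq_latticeGram_prod (subtorusPeriod Φ V hV hVc)
    (subtorusPeriod Φ (orthSubspace Φ η V) hW hWc) (pullbackForm (cxSpan Φ V).subtypeL η)
    (pullbackForm (cxSpan Φ (orthSubspace Φ η V)).subtypeL η) hGY hGZ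
  refine (forall_exists_int_iff_ker_isotropic _ Φ F hF hG).1 fun m₁ m₂ ↦ ?_
  -- the analytic representation of `μ` is `(y, z) ↦ y + z`
  have hFeq : ∀ w, F w = additionRep Φ V (orthSubspace Φ η V) w := fun w ↦ by
    obtain ⟨x, rfl⟩ := (prodPeriod (subtorusPeriod Φ V hV hVc) (subtorusPeriod Φ (orthSubspace Φ η V) hW hWc)).surjective w
    rw [← hF, additionRep_prodPeriod]
  have hsymm : ∀ e : E, additionRep Φ V (orthSubspace Φ η V) (F.symm e) = e := fun e ↦ by
    rw [← hFeq, ContinuousLinearEquiv.apply_symm_apply]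
  rw [← pullbackForm_additionRep_orthSubspace Φ hVc hWc, pullbackForm_apply, hsymm, hsymm]
  exact hη.2.1 m₁ m₂

omit [DecidableEq ι] in
/-- **`Ker μ ∩ (0 × Z) = 0`**: `μ(0, z) = ι_Z z = 0` forces `z = 0` (the embedding `ι_Z` is injective).
[cite: Auffarth2016NonSimplePPAV, §3, proof of Lemma 3.7 ("`H ∩ {0} × Y = H ∩ X × {0} = {(0,0)}`")] [cite: Lange2023AbelianVarietiesComplex, §2.4.4 Prop. 2.4.29 (proof), p. 125] -/
theorem ker_addition_inf_subtorus_sndSubspace :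
    (mapMatrixHom (prodPeriod (subtorusPeriod Φ V hV hVc) (subtorusPeriod Φ (orthSubspace Φ η V) hW hWc)) Φ
        (additionMatrix V (orthSubspace Φ η V))).ker ⊓
      subtorus (prodPeriod (subtorusPeriod Φ V hV hVc) (subtorusPeriod Φ (orthSubspace Φ η V) hW hWc))
        (sndSubspace : Submodule ℝ (Fin (subRank V) ⊕ Fin (subRank (orthSubspace Φ η V)) → ℝ)) = ⊥ := by
  rw [eq_bot_iff]
  rintro t ⟨ht, ht'⟩
  rw [AddSubgroup.mem_bot, eq_zero_iff_prodHomeomorph]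
  have h1 := (mem_subtorus_sndSubspace_iff _ _ t).1 ht'
  have h2 := (mem_ker_addition_iff Φ hV hVc hW hWc t).1 ht
  rw [h1, mapMatrix_zero', zero_add] at h2
  exact ⟨h1, subtorusMap_injective Φ _ hW hWc (by rw [h2, mapMatrix_zero'])⟩

omit [DecidableEq ι] in
/-- **`Ker μ ∩ (Y × 0) = 0`**: `μ(y, 0) = ι_Y y = 0` forces `y = 0`.
[cite: Auffarth2016NonSimplePPAV, §3, proof of Lemma 3.7 ("`H ∩ X × {0} = {(0,0)}`")] [cite: Lange2023AbelianVarietiesComplex, §2.4.4 Prop. 2.4.29 (proof), p. 125] -/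
theorem ker_addition_inf_subtorus_fstSubspace :
    (mapMatrixHom (prodPeriod (subtorusPeriod Φ V hV hVc) (subtorusPeriod Φ (orthSubspace Φ η V) hW hWc)) Φ
        (additionMatrix V (orthSubspace Φ η V))).ker ⊓
      subtorus (prodPeriod (subtorusPeriod Φ V hV hVc) (subtorusPeriod Φ (orthSubspace Φ η V) hW hWc))
        (fstSubspace : Submodule ℝ (Fin (subRank V) ⊕ Fin (subRank (orthSubspace Φ η V)) → ℝ)) = ⊥ := by
  rw [eq_bot_iff]
  rintro t ⟨ht, ht'⟩
  rw [AddSubgroup.mem_bot, eq_zero_iff_prodHomeomorph]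
  have h1 := (mem_subtorus_fstSubspace_iff _ _ t).1 ht'
  have h2 := (mem_ker_addition_iff Φ hV hVc hW hWc t).1 ht
  rw [h1, mapMatrix_zero', add_zero] at h2
  exact ⟨subtorusMap_injective Φ _ hV hVc (by rw [h2, mapMatrix_zero']), h1⟩

/-! ### §2 `#Ker μ = #K(ι_Y^*Θ) = #K(ι_Z^*Θ)` for a principal polarisation `Θ` (Cor. 5.3.4 / 5.3.5) -/

/-- **`deg μ = #K(ι_Y^*Θ)`** with `K(ι_Y^*Θ) = kerPhiH` of the polarised torus `(Y, ι_Y^*Θ)` (through the type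
`(d'ᵢ)` of `ι_Y^*Θ`: both equal `(∏ d'ᵢ)²`). [cite: Lange2023AbelianVarietiesComplex, §5.3.1 Cor. 5.3.4, p. 263] -/
theorem IsPrincipalPolarization.natCard_ker_addition_eq_natCard_kerPhiH_fst (hp : IsPrincipalPolarization Φ η)
    {GY : Matrix (Fin (subRank V)) (Fin (subRank V)) ℤ}
    (hGY : GY.map (Int.cast : ℤ → ℝ) = latticeGram (subtorusPeriod Φ V hV hVc) (pullbackForm (cxSpan Φ V).subtypeL η)) :
    Nat.card (mapMatrixHom (prodPeriod (subtorusPeriod Φ V hV hVc)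
        (subtorusPeriod Φ (orthSubspace Φ η V) hW hWc)) Φ (additionMatrix V (orthSubspace Φ η V))).ker =
      Nat.card (kerPhiH (subtorusPeriod Φ V hV hVc) GY) := by
  obtain ⟨s, d', hd', -⟩ := hp.isRiemannForm.exists_isSubPolarizationType Φ hV hVc
  rw [hp.natCard_ker_addition_eq_sq' Φ hV hVc hW hWc hd',
    (hd'.isPolarizationType_subtorusPeriod Φ hV hVc).natCard_kerPhiH
      (isRiemannForm_restrict Φ hp.isRiemannForm hV hVc) hGY]

/-- **`deg μ = #K(ι_Z^*Θ)`** (through the type `(dᵢ)` of `ι_Z^*Θ`; "`K(ι_Y^*Θ)` and `K(ι_Z^*Θ)` are isomorphic").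
[cite: Lange2023AbelianVarietiesComplex, §5.3.1 Cor. 5.3.4 and Cor. 5.3.5, p. 263] -/
theorem IsPrincipalPolarization.natCard_ker_addition_eq_natCard_kerPhiH_snd (hp : IsPrincipalPolarization Φ η)
    {GZ : Matrix (Fin (subRank (orthSubspace Φ η V))) (Fin (subRank (orthSubspace Φ η V))) ℤ}
    (hGZ : GZ.map (Int.cast : ℤ → ℝ) = latticeGram (subtorusPeriod Φ (orthSubspace Φ η V) hW hWc)
      (pullbackForm (cxSpan Φ (orthSubspace Φ η V)).subtypeL η)) :
    Nat.card (mapMatrixHom (prodPeriod (subtorusPeriod Φ V hV hVc)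
        (subtorusPeriod Φ (orthSubspace Φ η V) hW hWc)) Φ (additionMatrix V (orthSubspace Φ η V))).ker =
      Nat.card (kerPhiH (subtorusPeriod Φ (orthSubspace Φ η V) hW hWc) GZ) := by
  obtain ⟨r, d, hd, -⟩ := hp.isRiemannForm.exists_isSubPolarizationType Φ hW hWc
  rw [hp.natCard_ker_addition_eq_sq Φ hV hVc hW hWc hd,
    (hd.isPolarizationType_subtorusPeriod Φ hW hWc).natCard_kerPhiH
      (isRiemannForm_restrict Φ hp.isRiemannForm hW hWc) hGZ]

/-! ### §3 `Ker μ` is the graph of an antisymplectic isomorphism `p : K(ι_Y^*Θ) ≅ K(ι_Z^*Θ)` -/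

/-- **`Ker μ = graph(p)` for an ANTISYMPLECTIC isomorphism `p : K(ι_Y^*Θ) → K(ι_Z^*Θ)`** of the Weil pairings
of `(Y, ι_Y^*Θ)` and `(Z, ι_Z^*Θ)`, `Θ` a PRINCIPAL polarisation of `X` and `Z = Y^⊥`: the two projections
`Ker μ → K(ι_Y^*Θ)`, `Ker μ → K(ι_Z^*Θ)` are injective (the kernel meets the factors trivially) between groups
of the same order, hence bijective, and `p = pr₂ ∘ pr₁⁻¹`; it is antisymplectic because `Ker μ` is isotropic
for `ε^{ι_Y^*Θ ⊠ ι_Z^*Θ}` ("all principally polarized abelian varieties having `Y` and `Z` as complementary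
subvarieties arise this way" — the kernel half). [cite: IribarLopez2024NoetherLefschetzCycles, §2.2 Lemma 10] [cite: Auffarth2016NonSimplePPAV, §3 (Debarre's `Φ_{u,n−u}(D)` is surjective) and proof of Lemma 3.7] [cite: Lange2023AbelianVarietiesComplex, §5.3.1 Cor. 5.3.4, p. 263] -/
theorem IsPrincipalPolarization.exists_antisymplectic_graphSubgroup_eq_ker_addition
    (hp : IsPrincipalPolarization Φ η) {GY : Matrix (Fin (subRank V)) (Fin (subRank V)) ℤ}
    {GZ : Matrix (Fin (subRank (orthSubspace Φ η V))) (Fin (subRank (orthSubspace Φ η V))) ℤ}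
    (hGY : GY.map (Int.cast : ℤ → ℝ) = latticeGram (subtorusPeriod Φ V hV hVc) (pullbackForm (cxSpan Φ V).subtypeL η))
    (hGZ : GZ.map (Int.cast : ℤ → ℝ) = latticeGram (subtorusPeriod Φ (orthSubspace Φ η V) hW hWc)
      (pullbackForm (cxSpan Φ (orthSubspace Φ η V)).subtypeL η)) :
    ∃ p : kerPhiH (subtorusPeriod Φ V hV hVc) GY ≃+ kerPhiH (subtorusPeriod Φ (orthSubspace Φ η V) hW hWc) GZ,
      IsAntisymplectic (pullbackForm (cxSpan Φ V).subtypeL η)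
          (pullbackForm (cxSpan Φ (orthSubspace Φ η V)).subtypeL η) p.toAddMonoidHom ∧
        graphSubgroup _ _ p.toAddMonoidHom =
          (mapMatrixHom (prodPeriod (subtorusPeriod Φ V hV hVc)
            (subtorusPeriod Φ (orthSubspace Φ η V) hW hWc)) Φ (additionMatrix V (orthSubspace Φ η V))).ker := by
  -- notation-free abbreviations
  set ΦY := subtorusPeriod Φ V hV hVc with hΦY
  set ΦZ := subtorusPeriod Φ (orthSubspace Φ η V) hW hWc with hΦZ
  set K := (mapMatrixHom (prodPeriod ΦY ΦZ) Φ (additionMatrix V (orthSubspace Φ η V))).ker with hK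
  haveI : Finite K := finite_ker_addition_orthSubspace Φ hV hVc hW hWc hp.isRiemannForm
  haveI : Finite (kerPhiH ΦY GY) := (isRiemannForm_restrict Φ hp.isRiemannForm hV hVc).finite_kerPhiH hGY
  haveI : Finite (kerPhiH ΦZ GZ) := (isRiemannForm_restrict Φ hp.isRiemannForm hW hWc).finite_kerPhiH hGZ
  obtain ⟨hle, hiso⟩ := ker_addition_le_kerPhiH_and_weilPairing_eq_one Φ hV hVc hW hWc hp.isRiemannForm hGY hGZ
  have hmem : ∀ t : K, (prodHomeomorph ΦY ΦZ t.1).1 ∈ kerPhiH ΦY GY ∧ (prodHomeomorph ΦY ΦZ t.1).2 ∈ kerPhiH ΦZ GZ :=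
    fun t ↦ (mem_kerPhiH_prodPeriod_iff ΦY ΦZ GY GZ t.1).1 (hle t.2)
  -- the two projections
  let π₁ : K →+ kerPhiH ΦY GY :=
    { toFun := fun t ↦ ⟨(prodHomeomorph ΦY ΦZ t.1).1, (hmem t).1⟩
      map_zero' := Subtype.ext rfl
      map_add' := fun s t ↦ Subtype.ext rfl }
  let π₂ : K →+ kerPhiH ΦZ GZ :=
    { toFun := fun t ↦ ⟨(prodHomeomorph ΦY ΦZ t.1).2, (hmem t).2⟩
      map_zero' := Subtype.ext rfl
      map_add' := fun s t ↦ Subtype.ext rfl }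
  have hπ₁ : ∀ t : K, ((π₁ t : kerPhiH ΦY GY) : ComplexTorus ΦY) = (prodHomeomorph ΦY ΦZ t.1).1 := fun _ ↦ rfl
  have hπ₂ : ∀ t : K, ((π₂ t : kerPhiH ΦZ GZ) : ComplexTorus ΦZ) = (prodHomeomorph ΦY ΦZ t.1).2 := fun _ ↦ rfl
  -- injective: the kernel meets the factors trivially
  have hinj₁ : Injective π₁ := by
    rw [injective_iff_map_eq_zero]
    intro t ht
    have h0 : (prodHomeomorph ΦY ΦZ t.1).1 = 0 := by rw [← hπ₁, ht]; rfl
    have hbot : (t : ComplexTorus (prodPeriod ΦY ΦZ)) ∈ (⊥ : AddSubgroup (ComplexTorus (prodPeriod ΦY ΦZ))) := by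
      rw [← ker_addition_inf_subtorus_sndSubspace Φ hV hVc hW hWc]
      exact AddSubgroup.mem_inf.2 ⟨t.2, (mem_subtorus_sndSubspace_iff ΦY ΦZ t.1).2 h0⟩
    exact Subtype.ext (AddSubgroup.mem_bot.1 hbot)
  have hinj₂ : Injective π₂ := by
    rw [injective_iff_map_eq_zero]
    intro t ht
    have h0 : (prodHomeomorph ΦY ΦZ t.1).2 = 0 := by rw [← hπ₂, ht]; rfl
    have hbot : (t : ComplexTorus (prodPeriod ΦY ΦZ)) ∈ (⊥ : AddSubgroup (ComplexTorus (prodPeriod ΦY ΦZ))) := by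
      rw [← ker_addition_inf_subtorus_fstSubspace Φ hV hVc hW hWc]
      exact AddSubgroup.mem_inf.2 ⟨t.2, (mem_subtorus_fstSubspace_iff ΦY ΦZ t.1).2 h0⟩
    exact Subtype.ext (AddSubgroup.mem_bot.1 hbot)
  -- bijective: same orders
  have hbij₁ : Bijective π₁ := hinj₁.bijective_of_nat_card_le
    (hp.natCard_ker_addition_eq_natCard_kerPhiH_fst Φ hV hVc hW hWc hGY).symm.le
  have hbij₂ : Bijective π₂ := hinj₂.bijective_of_nat_card_le
    (hp.natCard_ker_addition_eq_natCard_kerPhiH_snd Φ hV hVc hW hWc hGZ).symm.le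
  let e₁ := AddEquiv.ofBijective π₁ hbij₁
  let e₂ := AddEquiv.ofBijective π₂ hbij₂
  let p : kerPhiH ΦY GY ≃+ kerPhiH ΦZ GZ := e₁.symm.trans e₂
  -- the graph of `p` is `K`
  have hgraph : graphSubgroup _ _ p.toAddMonoidHom = K := by
    ext t
    rw [mem_graphSubgroup_iff]
    constructor
    · rintro ⟨s, rfl⟩
      have ht : graphInclusion _ _ p.toAddMonoidHom s = (e₁.symm s).1 := by
        apply (prodHomeomorph ΦY ΦZ).injective
        rw [prodHomeomorph_graphInclusion, Prod.ext_iff]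
        refine ⟨?_, ?_⟩
        · change (s : ComplexTorus ΦY) = (prodHomeomorph ΦY ΦZ (e₁.symm s).1).1
          rw [← hπ₁]
          exact congrArg Subtype.val (e₁.apply_symm_apply s).symm
        · rfl
      rw [ht]
      exact (e₁.symm s).2
    · intro ht
      refine ⟨e₁ ⟨t, ht⟩, (prodHomeomorph ΦY ΦZ).injective ?_⟩
      rw [prodHomeomorph_graphInclusion, Prod.ext_iff]
      refine ⟨rfl, ?_⟩
      change ((e₂ (e₁.symm (e₁ ⟨t, ht⟩)) : kerPhiH ΦZ GZ) : ComplexTorus ΦZ) = (prodHomeomorph ΦY ΦZ t).2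
      rw [e₁.symm_apply_apply]
      rfl
  refine ⟨p, ?_, hgraph⟩
  -- antisymplectic: the graph is isotropic
  refine forall_weilPairing_graphSubgroup_eq_one_iff.1 fun s hs t ht ↦ hiso s ?_ t ?_
  · rw [hgraph] at hs; exact hs
  · rw [hgraph] at ht; exact ht

/-! ### §4 `(X, Θ) ≅ ((Y × Z)/Ker μ, θ)` as polarised tori, `θ` the descended `ι_Y^*Θ ⊠ ι_Z^*Θ` -/

/-- **`(X, Θ)` is the quotient `(Y × Z)/Ker μ` polarised by the descended `ι_Y^*Θ ⊠ ι_Z^*Θ`**: the two isogenies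
`π : Y × Z → (Y × Z)/Ker μ` and `μ : Y × Z → X` have the same kernel, so they differ by an isomorphism of
complex tori `h : (Y × Z)/Ker μ ⥲ X`, `h ∘ π = μ` (Lange §1.1.2 "up to isomorphisms every isogeny is of this type");
its analytic representation is that of `μ`, `(y, z) ↦ y + z`, which pulls `Θ` back to `ι_Y^*Θ ⊠ ι_Z^*Θ`
(Lemma 5.3.6), so `h` is an isomorphism of POLARISED tori.  Here `Θ` is any polarisation with `Z = Y^⊥`.
[cite: Lange2023AbelianVarietiesComplex, §1.1.2 (p. 21), §2.4.4 Cor. 2.4.24 (p. 123), §5.3.1 Lemma 5.3.6 (p. 263)] [cite: IribarLopez2024NoetherLefschetzCycles, §2.2 Lemma 10 ("arise this way")] -/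
theorem exists_isPolarizedIso_quotientBy_ker_addition (hη : IsRiemannForm Φ η)
    [Finite (mapMatrixHom (prodPeriod (subtorusPeriod Φ V hV hVc) (subtorusPeriod Φ (orthSubspace Φ η V) hW hWc))
      Φ (additionMatrix V (orthSubspace Φ η V))).ker] :
    ∃ h : ComplexTorus (quotientByPeriod (prodPeriod (subtorusPeriod Φ V hV hVc)
          (subtorusPeriod Φ (orthSubspace Φ η V) hW hWc))
          (mapMatrixHom (prodPeriod (subtorusPeriod Φ V hV hVc) (subtorusPeriod Φ (orthSubspace Φ η V) hW hWc)) Φ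
            (additionMatrix V (orthSubspace Φ η V))).ker) ≃+ ComplexTorus Φ,
      IsPolarizedIso (quotientByPeriod (prodPeriod (subtorusPeriod Φ V hV hVc)
          (subtorusPeriod Φ (orthSubspace Φ η V) hW hWc))
          (mapMatrixHom (prodPeriod (subtorusPeriod Φ V hV hVc) (subtorusPeriod Φ (orthSubspace Φ η V) hW hWc)) Φ
            (additionMatrix V (orthSubspace Φ η V))).ker)
        (prodForm (pullbackForm (cxSpan Φ V).subtypeL η) (pullbackForm (cxSpan Φ (orthSubspace Φ η V)).subtypeL η))
        Φ η h ∧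
      ∀ t, h (mapMatrix (prodPeriod (subtorusPeriod Φ V hV hVc)
          (subtorusPeriod Φ (orthSubspace Φ η V) hW hWc))
          (quotientByPeriod (prodPeriod (subtorusPeriod Φ V hV hVc)
          (subtorusPeriod Φ (orthSubspace Φ η V) hW hWc))
          (mapMatrixHom (prodPeriod (subtorusPeriod Φ V hV hVc) (subtorusPeriod Φ (orthSubspace Φ η V) hW hWc)) Φ
            (additionMatrix V (orthSubspace Φ η V))).ker) (quotientMatrix (prodPeriod (subtorusPeriod Φ V hV hVc)
          (subtorusPeriod Φ (orthSubspace Φ η V) hW hWc))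
          (mapMatrixHom (prodPeriod (subtorusPeriod Φ V hV hVc) (subtorusPeriod Φ (orthSubspace Φ η V) hW hWc)) Φ
            (additionMatrix V (orthSubspace Φ η V))).ker) t) =
        mapMatrix (prodPeriod (subtorusPeriod Φ V hV hVc)
          (subtorusPeriod Φ (orthSubspace Φ η V) hW hWc)) Φ (additionMatrix V (orthSubspace Φ η V)) t := by
  set ΦY := subtorusPeriod Φ V hV hVc with hΦY
  set ΦZ := subtorusPeriod Φ (orthSubspace Φ η V) hW hWc with hΦZ
  set K := (mapMatrixHom (prodPeriod ΦY ΦZ) Φ (additionMatrix V (orthSubspace Φ η V))).ker with hK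
  have hq := isIsogeny_quotientBy (prodPeriod ΦY ΦZ) K
  have hμ := isIsogeny_addition_orthSubspace Φ hη hV hVc hW hWc
  obtain ⟨C, C', hC, -, hC'C, hCC', ⟨g, hg⟩, -⟩ :=
    hq.exists_unimodular_of_ker_eq hμ (ker_mapMatrixHom_quotientBy (prodPeriod ΦY ΦZ) K)
  -- the analytic representation `g` of `ρ(C)` is `(y, z) ↦ y + z`
  have hgeq : ∀ w, g w = additionRep Φ V (orthSubspace Φ η V) w := fun w ↦ by
    obtain ⟨x, rfl⟩ := (prodPeriod ΦY ΦZ).surjective w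
    have h1 := hg ((quotientMatrix (prodPeriod ΦY ΦZ) K).map (Int.cast : ℤ → ℝ) *ᵥ x)
    rw [quotientPeriod_mulVec, Matrix.mulVec_mulVec, ← map_mul_intCast, hC,
      additionRep_prodPeriod Φ hV hVc hW hWc] at h1
    exact h1.symm
  obtain ⟨h, hh, hcoe, -⟩ := exists_isPolarizedIso_of_matrix hC'C hCC' g hg fun u v ↦ by
    rw [hgeq, hgeq, ← pullbackForm_apply, pullbackForm_additionRep_orthSubspace Φ hVc hWc]
  refine ⟨h, hh, fun t ↦ ?_⟩
  rw [hcoe, mapMatrix_mapMatrix, hC]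

/-- The same, with the subgroup as a parameter (for rewriting `Ker μ = graph(p)` under the binder).
[cite: Lange2023AbelianVarietiesComplex, §1.1.2 (p. 21) and §5.3.1 Lemma 5.3.6 (p. 263)] -/
theorem exists_isPolarizedIso_quotientBy_of_eq_ker_addition (hη : IsRiemannForm Φ η)
    (Γ : AddSubgroup (ComplexTorus (prodPeriod (subtorusPeriod Φ V hV hVc)
      (subtorusPeriod Φ (orthSubspace Φ η V) hW hWc)))) [Finite Γ]
    (hΓ : Γ = (mapMatrixHom (prodPeriod (subtorusPeriod Φ V hV hVc) (subtorusPeriod Φ (orthSubspace Φ η V) hW hWc))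
      Φ (additionMatrix V (orthSubspace Φ η V))).ker) :
    ∃ h : ComplexTorus (quotientByPeriod (prodPeriod (subtorusPeriod Φ V hV hVc)
          (subtorusPeriod Φ (orthSubspace Φ η V) hW hWc)) Γ) ≃+ ComplexTorus Φ,
      IsPolarizedIso (quotientByPeriod (prodPeriod (subtorusPeriod Φ V hV hVc)
          (subtorusPeriod Φ (orthSubspace Φ η V) hW hWc)) Γ)
        (prodForm (pullbackForm (cxSpan Φ V).subtypeL η) (pullbackForm (cxSpan Φ (orthSubspace Φ η V)).subtypeL η))
        Φ η h ∧
      ∀ t, h (mapMatrix (prodPeriod (subtorusPeriod Φ V hV hVc)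
          (subtorusPeriod Φ (orthSubspace Φ η V) hW hWc))
          (quotientByPeriod (prodPeriod (subtorusPeriod Φ V hV hVc)
          (subtorusPeriod Φ (orthSubspace Φ η V) hW hWc)) Γ)
          (quotientMatrix (prodPeriod (subtorusPeriod Φ V hV hVc)
          (subtorusPeriod Φ (orthSubspace Φ η V) hW hWc)) Γ) t) =
        mapMatrix (prodPeriod (subtorusPeriod Φ V hV hVc)
          (subtorusPeriod Φ (orthSubspace Φ η V) hW hWc)) Φ (additionMatrix V (orthSubspace Φ η V)) t := by
  subst hΓ
  exact exists_isPolarizedIso_quotientBy_ker_addition Φ hV hVc hW hWc hη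

/-! ### §5 Iribar López 2024, Lemma 10, last assertion, assembled -/

/-- **"All principally polarized abelian varieties having `Y` and `Z` as complementary subvarieties arise this
way."**  Let `(X, Θ)` be a principally polarised complex torus, `Y = π(V)` an abelian subvariety (`V` a lattice
subspace, `Φ(V)` complex) and `Z = π(V^⊥)` its complementary abelian subvariety, with their own complex-torus
structures `Y = ComplexTorus (subtorusPeriod Φ V …)`, `Z = ComplexTorus (subtorusPeriod Φ V^⊥ …)` and induced
polarisations `θ_Y = ι_Y^*Θ`, `θ_Z = ι_Z^*Θ` (integer Gram matrices `G_Y`, `G_Z`).  Then there are an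
ANTISYMPLECTIC isomorphism `p : K(θ_Y) ≅ K(θ_Z)` of the Weil pairings, whose graph is the kernel of the addition
isogeny `μ : Y × Z → X` (hence finite), and an isomorphism of POLARISED tori
`((Y × Z)/graph(p), θ_p) ≅ (X, Θ)`, `θ_p` Debarre's descended polarisation `θ_Y ⊠ θ_Z` of
`ComplexTorusAntisymplecticGraphQuotient`, carrying the projection `π` to `μ = ι_Y + ι_Z`.
[cite: IribarLopez2024NoetherLefschetzCycles, §2.2 Lemma 10 (last assertion)] [cite: Auffarth2016NonSimplePPAV, §3 ("Debarre shows that `Φ_{u,n−u}(D)` is surjective")] [cite: Debarre1988ThetaSingulierCodim3, (the original construction, via the two previous sources)] [cite: Lange2023AbelianVarietiesComplex, §5.3.1 Cor. 5.3.4, Lemma 5.3.6 (p. 263)] -/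
theorem IsPrincipalPolarization.exists_antisymplectic_isPolarizedIso_quotientBy_graphSubgroup
    (hp : IsPrincipalPolarization Φ η) {GY : Matrix (Fin (subRank V)) (Fin (subRank V)) ℤ}
    {GZ : Matrix (Fin (subRank (orthSubspace Φ η V))) (Fin (subRank (orthSubspace Φ η V))) ℤ}
    (hGY : GY.map (Int.cast : ℤ → ℝ) = latticeGram (subtorusPeriod Φ V hV hVc) (pullbackForm (cxSpan Φ V).subtypeL η))
    (hGZ : GZ.map (Int.cast : ℤ → ℝ) = latticeGram (subtorusPeriod Φ (orthSubspace Φ η V) hW hWc)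
      (pullbackForm (cxSpan Φ (orthSubspace Φ η V)).subtypeL η)) :
    ∃ (p : kerPhiH (subtorusPeriod Φ V hV hVc) GY ≃+ kerPhiH (subtorusPeriod Φ (orthSubspace Φ η V) hW hWc) GZ)
      (_ : IsAntisymplectic (pullbackForm (cxSpan Φ V).subtypeL η)
        (pullbackForm (cxSpan Φ (orthSubspace Φ η V)).subtypeL η) p.toAddMonoidHom)
      (_ : graphSubgroup _ _ p.toAddMonoidHom =
        (mapMatrixHom (prodPeriod (subtorusPeriod Φ V hV hVc)
          (subtorusPeriod Φ (orthSubspace Φ η V) hW hWc)) Φ (additionMatrix V (orthSubspace Φ η V))).ker)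
      (_ : Finite (graphSubgroup _ _ p.toAddMonoidHom))
      (h : ComplexTorus (quotientByPeriod (prodPeriod (subtorusPeriod Φ V hV hVc)
          (subtorusPeriod Φ (orthSubspace Φ η V) hW hWc)) (graphSubgroup _ _ p.toAddMonoidHom)) ≃+ ComplexTorus Φ),
      IsPolarizedIso (quotientByPeriod (prodPeriod (subtorusPeriod Φ V hV hVc)
          (subtorusPeriod Φ (orthSubspace Φ η V) hW hWc)) (graphSubgroup _ _ p.toAddMonoidHom))
        (prodForm (pullbackForm (cxSpan Φ V).subtypeL η) (pullbackForm (cxSpan Φ (orthSubspace Φ η V)).subtypeL η))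
        Φ η h ∧
      ∀ t, h (mapMatrix (prodPeriod (subtorusPeriod Φ V hV hVc)
          (subtorusPeriod Φ (orthSubspace Φ η V) hW hWc))
          (quotientByPeriod (prodPeriod (subtorusPeriod Φ V hV hVc)
          (subtorusPeriod Φ (orthSubspace Φ η V) hW hWc)) (graphSubgroup _ _ p.toAddMonoidHom))
          (quotientMatrix (prodPeriod (subtorusPeriod Φ V hV hVc)
          (subtorusPeriod Φ (orthSubspace Φ η V) hW hWc)) (graphSubgroup _ _ p.toAddMonoidHom)) t) =
        mapMatrix (prodPeriod (subtorusPeriod Φ V hV hVc)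
          (subtorusPeriod Φ (orthSubspace Φ η V) hW hWc)) Φ (additionMatrix V (orthSubspace Φ η V)) t := by
  obtain ⟨p, hp₁, hp₂⟩ := hp.exists_antisymplectic_graphSubgroup_eq_ker_addition Φ hV hVc hW hWc hGY hGZ
  haveI : Finite (kerPhiH (subtorusPeriod Φ V hV hVc) GY) :=
    (isRiemannForm_restrict Φ hp.isRiemannForm hV hVc).finite_kerPhiH hGY
  haveI hfin : Finite (graphSubgroup _ _ p.toAddMonoidHom) := finite_graphSubgroup _ _ _
  obtain ⟨h, hh, hcomp⟩ := exists_isPolarizedIso_quotientBy_of_eq_ker_addition Φ hV hVc hW hWc hp.isRiemannForm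
    (graphSubgroup _ _ p.toAddMonoidHom) hp₂
  exact ⟨p, hp₁, hp₂, hfin, h, hh, hcomp⟩

/-- **Corollary: `(X, Θ)` is isomorphic, as a polarised torus, to a Debarre twisted product of its complementary
pair** — the existence form consumed on the Siegel side (`(X, Θ) ≅ ((Y × Z)/graph(p), θ_p)` with `p`
antisymplectic and bijective). [cite: IribarLopez2024NoetherLefschetzCycles, §2.2 Lemma 10 (last assertion)] -/
theorem IsPrincipalPolarization.exists_antisymplectic_isPolarizedIso_quotientBy_graphSubgroup'
    (hp : IsPrincipalPolarization Φ η) {GY : Matrix (Fin (subRank V)) (Fin (subRank V)) ℤ}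
    {GZ : Matrix (Fin (subRank (orthSubspace Φ η V))) (Fin (subRank (orthSubspace Φ η V))) ℤ}
    (hGY : GY.map (Int.cast : ℤ → ℝ) = latticeGram (subtorusPeriod Φ V hV hVc) (pullbackForm (cxSpan Φ V).subtypeL η))
    (hGZ : GZ.map (Int.cast : ℤ → ℝ) = latticeGram (subtorusPeriod Φ (orthSubspace Φ η V) hW hWc)
      (pullbackForm (cxSpan Φ (orthSubspace Φ η V)).subtypeL η)) :
    ∃ (p : kerPhiH (subtorusPeriod Φ V hV hVc) GY →+ kerPhiH (subtorusPeriod Φ (orthSubspace Φ η V) hW hWc) GZ)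
      (_ : Bijective p)
      (_ : IsAntisymplectic (pullbackForm (cxSpan Φ V).subtypeL η)
        (pullbackForm (cxSpan Φ (orthSubspace Φ η V)).subtypeL η) p)
      (_ : Finite (graphSubgroup _ _ p))
      (h : ComplexTorus Φ ≃+ ComplexTorus (quotientByPeriod (prodPeriod (subtorusPeriod Φ V hV hVc)
          (subtorusPeriod Φ (orthSubspace Φ η V) hW hWc)) (graphSubgroup _ _ p))),
      IsPolarizedIso Φ η (quotientByPeriod (prodPeriod (subtorusPeriod Φ V hV hVc)
          (subtorusPeriod Φ (orthSubspace Φ η V) hW hWc)) (graphSubgroup _ _ p))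
        (prodForm (pullbackForm (cxSpan Φ V).subtypeL η) (pullbackForm (cxSpan Φ (orthSubspace Φ η V)).subtypeL η))
        h := by
  obtain ⟨p, hp₁, -, hfin, h, hh, -⟩ :=
    hp.exists_antisymplectic_isPolarizedIso_quotientBy_graphSubgroup Φ hV hVc hW hWc hGY hGZ
  exact ⟨p.toAddMonoidHom, p.bijective, hp₁, hfin, h.symm, hh.symm⟩

/-! ### §6 The isomorphism `(Y × Z)/Γ ≅ X` carries the images of the factors onto `Y` and `Z` -/

omit [DecidableEq ι] in
/-- **Under an isomorphism `h : (Y × Z)/Γ ≅ X` with `h ∘ π = μ` the image `π(Y × 0)` of the first factor goes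
onto `Y = π(V)`**: `h(π(y, 0)) = μ(y, 0) = ι_Y(y)`, and `ι_Y` maps `Y` onto `π(V)` — so the complementary pair of
the twisted product (FILE B) is carried to the given pair `(Y, Z)` of `X` ("contains `(Y, θ_Y)`, `(Z, θ_Z)` as
complementary subvarieties", read through the isomorphism of §5).
[cite: IribarLopez2024NoetherLefschetzCycles, §2.2 Lemma 10] [cite: Lange2023AbelianVarietiesComplex, §5.3.1 Cor. 5.3.4, Lemma 5.3.6 ("`μ = ι_Y + ι_Z`", p. 263)] -/
theorem map_subtorus_fstSubspace_eq_subtorus_of_comp_eq_addition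
    {Γ : AddSubgroup (ComplexTorus (prodPeriod (subtorusPeriod Φ V hV hVc)
      (subtorusPeriod Φ (orthSubspace Φ η V) hW hWc)))} [Finite Γ]
    (h : ComplexTorus (quotientByPeriod (prodPeriod (subtorusPeriod Φ V hV hVc)
      (subtorusPeriod Φ (orthSubspace Φ η V) hW hWc)) Γ) ≃+ ComplexTorus Φ)
    (hcomp : ∀ t, h (mapMatrix (prodPeriod (subtorusPeriod Φ V hV hVc)
          (subtorusPeriod Φ (orthSubspace Φ η V) hW hWc))
          (quotientByPeriod (prodPeriod (subtorusPeriod Φ V hV hVc)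
          (subtorusPeriod Φ (orthSubspace Φ η V) hW hWc)) Γ)
          (quotientMatrix (prodPeriod (subtorusPeriod Φ V hV hVc)
          (subtorusPeriod Φ (orthSubspace Φ η V) hW hWc)) Γ) t) =
        mapMatrix (prodPeriod (subtorusPeriod Φ V hV hVc)
          (subtorusPeriod Φ (orthSubspace Φ η V) hW hWc)) Φ (additionMatrix V (orthSubspace Φ η V)) t) :
    ((subtorus (prodPeriod (subtorusPeriod Φ V hV hVc) (subtorusPeriod Φ (orthSubspace Φ η V) hW hWc))
        (fstSubspace : Submodule ℝ (Fin (subRank V) ⊕ Fin (subRank (orthSubspace Φ η V)) → ℝ))).map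
      (mapMatrixHom (prodPeriod (subtorusPeriod Φ V hV hVc) (subtorusPeriod Φ (orthSubspace Φ η V) hW hWc))
        (quotientByPeriod (prodPeriod (subtorusPeriod Φ V hV hVc)
          (subtorusPeriod Φ (orthSubspace Φ η V) hW hWc)) Γ)
        (quotientMatrix (prodPeriod (subtorusPeriod Φ V hV hVc)
          (subtorusPeriod Φ (orthSubspace Φ η V) hW hWc)) Γ))).map h.toAddMonoidHom =
      subtorus Φ V := by
  rw [AddSubgroup.map_map]
  ext x
  rw [AddSubgroup.mem_map]
  have key : ∀ t, (h.toAddMonoidHom.comp (mapMatrixHom (prodPeriod (subtorusPeriod Φ V hV hVc)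
      (subtorusPeriod Φ (orthSubspace Φ η V) hW hWc)) (quotientByPeriod (prodPeriod (subtorusPeriod Φ V hV hVc)
      (subtorusPeriod Φ (orthSubspace Φ η V) hW hWc)) Γ) (quotientMatrix (prodPeriod (subtorusPeriod Φ V hV hVc)
      (subtorusPeriod Φ (orthSubspace Φ η V) hW hWc)) Γ))) t =
      mapMatrix (prodPeriod (subtorusPeriod Φ V hV hVc) (subtorusPeriod Φ (orthSubspace Φ η V) hW hWc)) Φ
        (additionMatrix V (orthSubspace Φ η V)) t := fun t ↦ hcomp t
  simp only [key]
  constructor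
  · rintro ⟨t, ht, rfl⟩
    rw [mapMatrix_additionMatrix, (mem_subtorus_fstSubspace_iff _ _ t).1 ht, mapMatrix_zero', add_zero]
    exact mapMatrix_subtorusMatrix_mem_subtorus Φ hV hVc _
  · intro hx
    obtain ⟨y, rfl⟩ := exists_mapMatrix_subtorusMatrix_eq Φ hV hVc hx
    refine ⟨(prodHomeomorph (subtorusPeriod Φ V hV hVc) (subtorusPeriod Φ (orthSubspace Φ η V) hW hWc)).symm
      (y, 0), (mem_subtorus_fstSubspace_iff _ _ _).2 (by rw [Homeomorph.apply_symm_apply]), ?_⟩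
    rw [mapMatrix_additionMatrix, Homeomorph.apply_symm_apply, mapMatrix_zero', add_zero]

omit [DecidableEq ι] in
/-- **… and the image `π(0 × Z)` of the second factor goes onto `Z = π(V^⊥)`** (`h(π(0, z)) = ι_Z(z)`).
[cite: IribarLopez2024NoetherLefschetzCycles, §2.2 Lemma 10] [cite: Lange2023AbelianVarietiesComplex, §5.3.1 Cor. 5.3.4, Lemma 5.3.6 (p. 263)] -/
theorem map_subtorus_sndSubspace_eq_subtorus_of_comp_eq_addition
    {Γ : AddSubgroup (ComplexTorus (prodPeriod (subtorusPeriod Φ V hV hVc)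
      (subtorusPeriod Φ (orthSubspace Φ η V) hW hWc)))} [Finite Γ]
    (h : ComplexTorus (quotientByPeriod (prodPeriod (subtorusPeriod Φ V hV hVc)
      (subtorusPeriod Φ (orthSubspace Φ η V) hW hWc)) Γ) ≃+ ComplexTorus Φ)
    (hcomp : ∀ t, h (mapMatrix (prodPeriod (subtorusPeriod Φ V hV hVc)
          (subtorusPeriod Φ (orthSubspace Φ η V) hW hWc))
          (quotientByPeriod (prodPeriod (subtorusPeriod Φ V hV hVc)
          (subtorusPeriod Φ (orthSubspace Φ η V) hW hWc)) Γ)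
          (quotientMatrix (prodPeriod (subtorusPeriod Φ V hV hVc)
          (subtorusPeriod Φ (orthSubspace Φ η V) hW hWc)) Γ) t) =
        mapMatrix (prodPeriod (subtorusPeriod Φ V hV hVc)
          (subtorusPeriod Φ (orthSubspace Φ η V) hW hWc)) Φ (additionMatrix V (orthSubspace Φ η V)) t) :
    ((subtorus (prodPeriod (subtorusPeriod Φ V hV hVc) (subtorusPeriod Φ (orthSubspace Φ η V) hW hWc))
        (sndSubspace : Submodule ℝ (Fin (subRank V) ⊕ Fin (subRank (orthSubspace Φ η V)) → ℝ))).map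
      (mapMatrixHom (prodPeriod (subtorusPeriod Φ V hV hVc) (subtorusPeriod Φ (orthSubspace Φ η V) hW hWc))
        (quotientByPeriod (prodPeriod (subtorusPeriod Φ V hV hVc)
          (subtorusPeriod Φ (orthSubspace Φ η V) hW hWc)) Γ)
        (quotientMatrix (prodPeriod (subtorusPeriod Φ V hV hVc)
          (subtorusPeriod Φ (orthSubspace Φ η V) hW hWc)) Γ))).map h.toAddMonoidHom =
      subtorus Φ (orthSubspace Φ η V) := by
  rw [AddSubgroup.map_map]
  ext x
  rw [AddSubgroup.mem_map]
  have key : ∀ t, (h.toAddMonoidHom.comp (mapMatrixHom (prodPeriod (subtorusPeriod Φ V hV hVc)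
      (subtorusPeriod Φ (orthSubspace Φ η V) hW hWc)) (quotientByPeriod (prodPeriod (subtorusPeriod Φ V hV hVc)
      (subtorusPeriod Φ (orthSubspace Φ η V) hW hWc)) Γ) (quotientMatrix (prodPeriod (subtorusPeriod Φ V hV hVc)
      (subtorusPeriod Φ (orthSubspace Φ η V) hW hWc)) Γ))) t =
      mapMatrix (prodPeriod (subtorusPeriod Φ V hV hVc) (subtorusPeriod Φ (orthSubspace Φ η V) hW hWc)) Φ
        (additionMatrix V (orthSubspace Φ η V)) t := fun t ↦ hcomp t
  simp only [key]
  constructor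
  · rintro ⟨t, ht, rfl⟩
    rw [mapMatrix_additionMatrix, (mem_subtorus_sndSubspace_iff _ _ t).1 ht, mapMatrix_zero', zero_add]
    exact mapMatrix_subtorusMatrix_mem_subtorus Φ hW hWc _
  · intro hx
    obtain ⟨z, rfl⟩ := exists_mapMatrix_subtorusMatrix_eq Φ hW hWc hx
    refine ⟨(prodHomeomorph (subtorusPeriod Φ V hV hVc) (subtorusPeriod Φ (orthSubspace Φ η V) hW hWc)).symm
      (0, z), (mem_subtorus_sndSubspace_iff _ _ _).2 (by rw [Homeomorph.apply_symm_apply]), ?_⟩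
    rw [mapMatrix_additionMatrix, Homeomorph.apply_symm_apply, mapMatrix_zero', zero_add]

/-- **Hence, in the setting of §5: the polarised isomorphism `((Y × Z)/graph(p), θ_p) ≅ (X, Θ)` identifies the
complementary pair `(π(Y × 0), π(0 × Z))` of the twisted product with the given pair `(Y, Z) = (π(V), π(V^⊥))`.**
[cite: IribarLopez2024NoetherLefschetzCycles, §2.2 Lemma 10 ("contains `(Y, θ_Y)`, `(Z, θ_Z)` as complementary subvarieties … all … arise this way")] [cite: Lange2023AbelianVarietiesComplex, §5.3.1 Cor. 5.3.4 (p. 263)] -/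
theorem IsPrincipalPolarization.exists_antisymplectic_isPolarizedIso_quotientBy_graphSubgroup_map_subtorus
    (hp : IsPrincipalPolarization Φ η) {GY : Matrix (Fin (subRank V)) (Fin (subRank V)) ℤ}
    {GZ : Matrix (Fin (subRank (orthSubspace Φ η V))) (Fin (subRank (orthSubspace Φ η V))) ℤ}
    (hGY : GY.map (Int.cast : ℤ → ℝ) = latticeGram (subtorusPeriod Φ V hV hVc) (pullbackForm (cxSpan Φ V).subtypeL η))
    (hGZ : GZ.map (Int.cast : ℤ → ℝ) = latticeGram (subtorusPeriod Φ (orthSubspace Φ η V) hW hWc)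
      (pullbackForm (cxSpan Φ (orthSubspace Φ η V)).subtypeL η)) :
    ∃ (p : kerPhiH (subtorusPeriod Φ V hV hVc) GY ≃+ kerPhiH (subtorusPeriod Φ (orthSubspace Φ η V) hW hWc) GZ)
      (_ : IsAntisymplectic (pullbackForm (cxSpan Φ V).subtypeL η)
        (pullbackForm (cxSpan Φ (orthSubspace Φ η V)).subtypeL η) p.toAddMonoidHom)
      (_ : Finite (graphSubgroup _ _ p.toAddMonoidHom))
      (h : ComplexTorus (quotientByPeriod (prodPeriod (subtorusPeriod Φ V hV hVc)
          (subtorusPeriod Φ (orthSubspace Φ η V) hW hWc)) (graphSubgroup _ _ p.toAddMonoidHom)) ≃+ ComplexTorus Φ),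
      IsPolarizedIso (quotientByPeriod (prodPeriod (subtorusPeriod Φ V hV hVc)
          (subtorusPeriod Φ (orthSubspace Φ η V) hW hWc)) (graphSubgroup _ _ p.toAddMonoidHom))
        (prodForm (pullbackForm (cxSpan Φ V).subtypeL η) (pullbackForm (cxSpan Φ (orthSubspace Φ η V)).subtypeL η))
        Φ η h ∧
      ((subtorus (prodPeriod (subtorusPeriod Φ V hV hVc) (subtorusPeriod Φ (orthSubspace Φ η V) hW hWc))
          (fstSubspace : Submodule ℝ (Fin (subRank V) ⊕ Fin (subRank (orthSubspace Φ η V)) → ℝ))).map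
        (mapMatrixHom _ _ (quotientMatrix (prodPeriod (subtorusPeriod Φ V hV hVc)
          (subtorusPeriod Φ (orthSubspace Φ η V) hW hWc)) (graphSubgroup _ _ p.toAddMonoidHom)))).map
        h.toAddMonoidHom = subtorus Φ V ∧
      ((subtorus (prodPeriod (subtorusPeriod Φ V hV hVc) (subtorusPeriod Φ (orthSubspace Φ η V) hW hWc))
          (sndSubspace : Submodule ℝ (Fin (subRank V) ⊕ Fin (subRank (orthSubspace Φ η V)) → ℝ))).map
        (mapMatrixHom _ _ (quotientMatrix (prodPeriod (subtorusPeriod Φ V hV hVc)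
          (subtorusPeriod Φ (orthSubspace Φ η V) hW hWc)) (graphSubgroup _ _ p.toAddMonoidHom)))).map
        h.toAddMonoidHom = subtorus Φ (orthSubspace Φ η V) := by
  obtain ⟨p, hp₁, -, hfin, h, hh, hcomp⟩ :=
    hp.exists_antisymplectic_isPolarizedIso_quotientBy_graphSubgroup Φ hV hVc hW hWc hGY hGZ
  exact ⟨p, hp₁, hfin, h, hh,
    map_subtorus_fstSubspace_eq_subtorus_of_comp_eq_addition Φ hV hVc hW hWc h hcomp,
    map_subtorus_sndSubspace_eq_subtorus_of_comp_eq_addition Φ hV hVc hW hWc h hcomp⟩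

end ComplexTorus

end Literature.Geometry.Kaehler

end
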